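import Literature.AnabelianGeometry.EtaleTheta.Thm56SubdagStatements
import Literature.AnabelianGeometry.EtaleTheta.FrobenioidThetaOfBiKummerData
import Literature.AnabelianGeometry.EtaleTheta.ThetaRigidity
import HarnessLib

/-!
# [EtTh] Prop. 5.5, proof p.327 (PDF p.101) l.−3 – p.328 l.1 — sub-node **EtTh:Prop5.5/P55-L02**
# `EtaTautological` AT THE §5 CARRIER `ThetaFrobenioid.ofBiKummerData`: the mod-`N` theta cocycle DESCENDED to
# `H_{B_N}` along `ρ : Π^tp_X ↠ Aut_D(B_N^bs)` IS the projection on the part over `(l·Δ_Θ)_{B_N}` (proof-only)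

Mochizuki, *The étale theta function and its Frobenioid-theoretic manifestations*, Publ. RIMS **45** (2009), proof of
Prop. 5.5, p.327 (PDF p.101) l.−3 – p.328 l.1: «if `S″ ∈ Ob(C)` is an `l·N`-codomain of an `l·N`-th root of a right
fraction-pair of `Θ̈` [Prop. 5.2 (i)], then it follows from the detailed description of the "étale theta class" in
Proposition 1.3 that the resulting Kummer class [cf. Proposition 5.2, (iii)] determines an isomorphism
`(l·Δ_Θ)_{S″} ⊗ ℤ/Nℤ ⥲ μ_N(S″)`» [cite: MochizukiEtTh2009, Prop 5.5 proof p.327 (PDF p.101)]; the CONTENT of the appeal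
to Prop. 1.3 / Prop. 1.5 (iii) («`η̈^Θ` restricts to `log(Θ)` on `Δ_Θ`») is abc-iut-L2-t2's interface field
`RigidData.cocycle_lDeltaTheta` ("on `(l·Δ_Θ)` the theta cocycles ARE the identification with `μ_N`", Rmk. 2.19.2 p.67,
[cite: MochizukiEtTh2009, Cor 2.18 p.59]) — PROVED for the §1 setting by abc-iut-L2-t8 (`RigidOfSetting.lean`,
`C.rigidData μ hC hS h15 L`, from the named fact `Prop15iii`).

abc-iut cell, layer L2, plan/L2/SUBDAG-EtTh-Thm56.md row **P55-L02** (abc-iut-L2-lead ROW for seat abc-iut-w5-d123,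
2026-08-26T02:46Z / routing 02:54Z).  PROOF-ONLY file (0 definitions, 0 new named facts); the statement of record is
abc-iut-w5-d020's `ThetaFrobenioid.Thm56Sub.EtaTautological` (Thm56SubdagStatements.lean, p417674 ✓), the carrier is
abc-iut-L2-t4's `ThetaFrobenioid.ofBiKummerData` (FrobenioidThetaOfBiKummerData.lean, p417743 ✓; merge row W3-L2-01),
whose tempered groups and `ρ` are those of a §2 `ThetaEnvData` (`PiX`, `PiYdd`, `ρ = rhoOfBiKummerData R ιX`,
`H_{B_N} = PiYdd.map ρ` — the file's `rfl` dictionary).  Here the §2 data are a `RigidData` (`T := RD.toThetaEnvData`).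

What is PROVED:
* §1 **descent of a theta cocycle along `ρ`** (MERGE-PLAN row 6, the `η`-half of the Prop. 5.2 (iii) pin): for ANY
  `ThetaEnvData T`, any homomorphism `ρ` out of `Π^tp_X`, and any member `η₀` of the collection of mod-`N` theta cocycles,
  IF `η₀` dies on `Ker ρ ∩ Π^tp_Ÿ` (`hdies` — the ONE named input of this file on the `η`-side: «the mod-`N` étale theta
  class vanishes on `Π_{B_N} ∩ Π^tp_Ÿ̲̲`», i.e. `B_N` is an `l·N`-codomain; its discharge belongs with the definition of the
  covering under `B_N` in the carrier, GAP-LEDGER row G-w5d123-1), THEN `η₀` is constant on the fibres of `ρ|_{Π^tp_Ÿ}`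
  (`ThetaEnvData.thetaCocycle_eq_of_map_eq` — the cocycle law `η₀(gh) = η₀(g)·χ(g)η₀(h)` and `η₀(b) = 1`) and hence
  DESCENDS to a function on the image `ρ(Π^tp_Ÿ) = H_{B_N}` with any prescribed coefficient identification `e`
  (`ThetaEnvData.exists_descent_thetaCocycle`);
* §2 **the closer** `ThetaFrobenioid.etaTautological_ofBiKummerData : EtaTautological 𝔉 P η` for
  `𝔉 := ofBiKummerData …` over a `RigidData`, every `η : H_{B_N} → (l·Δ_Θ)_{B_N} ⊗ ℤ/Nℤ` satisfying the descent law
  (`hη`), and every subquotient datum `P` satisfying the two ROW-2 laws `hlift` (an element of `H_{B_N}` over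
  `(l·Δ_Θ)_{B_N}` lifts to `Π^tp_Ÿ ∩ θ⁻¹(l·Δ_Θ)`) and `hP` (`P.proj ∘ ρ` is `thetaMod` read through `e`) — NAMED binders,
  the REAL `(l·Δ_Θ)_{(−)}` at `B_N^bs` being abc-iut-L2-t9's merge row 2 (GAP-LEDGER row G-w5d123-2); the proof is
  `hη` + `RigidData.cocycle_lDeltaTheta` + `hP`;
* `ThetaFrobenioid.exists_eta_etaTautological_ofBiKummerData` — §1 + §2: under `hdies`, `hlift`, `hP` there IS an
  `η` on `H_{B_N}` with the descent law for which `EtaTautological 𝔉 P η` holds.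

HONEST FRAMING: conditional discharge — trust base = {`hdies` (row 6), `hlift`/`hP` (row 2), the identification `e`}
plus whatever the `RigidData` was built from (for `C.rigidData …`: the named fact `Prop15iii`); [EtTh] is refereed;
nothing here bears on [IUTchIII] Cor. 3.12; typed ≠ proved elsewhere is untouched.
-/

noncomputable section

namespace Literature.AnabelianGeometry.EtaleTheta

open CategoryTheory FrobenioidCyclotomicRigidity Literature.AlgebraicGeometry.Frobenioids

universe u₀ v₀ u v w

/-! ### §1 Descent of a mod-`N` theta cocycle along a homomorphism out of `Π^tp_X` -/

namespace ThetaEnvData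

variable {N : ℕ+} (T : ThetaEnvData.{u} N) {A : Type*} [Group A] (ρ : T.PiX →* A)
  {η₀ : T.PiYdd → T.mu}

/-- **Descent, fibre form** (MERGE-PLAN row 6, `η`-half): if the mod-`N` theta cocycle `η₀` dies on
`Ker ρ ∩ Π^tp_Ÿ` («the mod-`N` étale theta class vanishes on `Π_{B_N} ∩ Π^tp_Ÿ̲̲`: `B_N` is an `l·N`-codomain», Prop.
5.2 (i)/(iii)), then `η₀` is constant on the fibres of `ρ` restricted to `Π^tp_Ÿ`: for `ρ k₁ = ρ k₂` one has
`η₀ k₂ = η₀ (k₁ · k₁⁻¹k₂) = η₀ k₁ · χ(k₁) η₀(k₁⁻¹k₂) = η₀ k₁`. [cite: MochizukiEtTh2009, Prop 5.2 (iii) p.324 (PDF p.98)] -/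
theorem thetaCocycle_eq_of_map_eq (hη₀ : η₀ ∈ T.thetaCocycles)
    (hdies : ∀ k : T.PiYdd, ρ k = 1 → η₀ k = 1) (k₁ k₂ : T.PiYdd) (h : ρ k₁ = ρ k₂) :
    η₀ k₁ = η₀ k₂ := by
  have hb : ρ ((k₁⁻¹ * k₂ : T.PiYdd) : T.PiX) = 1 := by
    rw [Subgroup.coe_mul, Subgroup.coe_inv, map_mul, map_inv, h, inv_mul_cancel]
  have hlaw := T.isCocycle η₀ hη₀ k₁ (k₁⁻¹ * k₂)
  rw [mul_inv_cancel_left, hdies _ hb, map_one, mul_one] at hlaw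
  exact hlaw.symm

/-- **Descent of the theta cocycle to `H = ρ(Π^tp_Ÿ)`** (MERGE-PLAN row 6, `η`-half; in §5: `H_{B_N} ⊆ Aut_D(B_N^bs)`,
p.331 (PDF p.105)): under `hdies` there is a function `η` on the image subgroup `ρ(Π^tp_Ÿ)`, valued through any
coefficient identification `e` («relative to the natural isomorphism `μ_N = (l·Δ_Θ) ⊗ ℤ/Nℤ`», p.324/p.46), with
`η(ρ k) = e(η₀ k)` for every `k ∈ Π^tp_Ÿ`. [cite: MochizukiEtTh2009, Prop 5.2 (iii) p.324 (PDF p.98)] -/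
theorem exists_descent_thetaCocycle (hη₀ : η₀ ∈ T.thetaCocycles)
    (hdies : ∀ k : T.PiYdd, ρ k = 1 → η₀ k = 1) {B : Type*} (e : T.mu → B) :
    ∃ η : T.PiYdd.map ρ → B, ∀ k : T.PiYdd, η ⟨ρ k, Subgroup.mem_map_of_mem ρ k.2⟩ = e (η₀ k) := by
  classical
  refine ⟨fun a => e (η₀ ⟨Classical.choose (Subgroup.mem_map.mp a.2),
    (Classical.choose_spec (Subgroup.mem_map.mp a.2)).1⟩), fun k => ?_⟩
  have hspec := Classical.choose_spec (Subgroup.mem_map.mp (Subgroup.mem_map_of_mem ρ k.2))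
  exact congrArg e (T.thetaCocycle_eq_of_map_eq ρ hη₀ hdies ⟨_, hspec.1⟩ k hspec.2)

end ThetaEnvData

/-! ### §2 `EtaTautological` at the carrier `ThetaFrobenioid.ofBiKummerData` -/

namespace ThetaFrobenioid

variable {K : Type u₀} [Field K]
  {X : SemiGraphs.TemperedArithmeticGroup.{u₀} K} {D₀ : Type u₀} [Category.{v₀} D₀]
  {V : FrdIMonoidStub.{w}} {T₀ : RealifiedDivisorMonoids (D₀ := D₀) V} {D : Type u} [Category.{v} D]
  {VD : FrdICatStub.{u, v, w} D} {S : BiKummerSetting X T₀ D VD}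
  {pullFrac : ∀ {A A' : S.C} (_ : A' ⟶ A), S.biratUnits A → S.biratUnits A'}
  {lv N : ℕ+} {l' : ℕ} {RD : RigidData.{max v w} N l'} {θ : S.biratUnits S.Aodot} {Bl : S.C}
  {Pl : S.FractionPair θ Bl} {Rl : S.NthRoot θ Pl lv pullFrac}
  (h : ModelFrobenioid.Hypotheses S.tf.divisorMonoid S.tf.ratFnFunctor)
  (toB : ∀ A : S.C, S.biratUnits A →* S.tf.biratUnitsModel A) (Q : FrobenioidTheta.ThetaSubquotientStub.{w} D)
  (odd_l : Odd (lv : ℕ)) (R : S.NthRoot Rl.root Rl.pair N pullFrac) (ιX : RD.PiX ≃ₜ* X.Pi)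
  (hopen : IsOpen ((S.galoisSurj R.AN.base R.αData.isGalois).ker : Set X.Pi)) (σ : Aut R.AN.base →* Aut R.AN)
  (K' : Type w) [Field K'] (constEmb : K'ˣ →* S.tf.biratUnitsModel R.BN)
  (constEmb_injective : Function.Injective constEmb)
  (hdivc : ∀ g : Aut R.BN.base,
    ModelFrobenioid.div ((σ ((BiKummerSetting.NthRoot.baseIso S R).conjAut.symm g)).hom ≫ R.pair.num) =
      ModelFrobenioid.div R.pair.num)
  (hdivp : ∀ y : RD.PiYdd,
    ModelFrobenioid.div ((σ (S.galoisSurj R.AN.base R.αData.isGalois (ιX y.1))).hom ≫ R.pair.den) =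
      ModelFrobenioid.div R.pair.den)

/-- **EtTh:Prop5.5/P55-L02 at the carrier** («it follows from the detailed description of the "étale theta class" in
Proposition 1.3 that the resulting Kummer class … determines an isomorphism `(l·Δ_Θ)_{S″} ⊗ ℤ/Nℤ ⥲ μ_N(S″)`», p.327
(PDF p.101) l.−3): for the §5 data `𝔉 := ofBiKummerData …` assembled over a §2 `RigidData` (`Π^tp_X̲ := RD.PiX`,
`Π^tp_Ÿ̲ := RD.PiYdd`, `ρ = rhoOfBiKummerData R ιX`, `H_{B_N} = ρ(Π^tp_Ÿ̲)`), EVERY `η : H_{B_N} → (l·Δ_Θ)_{B_N} ⊗ ℤ/Nℤ`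
obtained by descending a mod-`N` theta cocycle `η₀` along `ρ` through a coefficient identification `e` (`hη`) is
TAUTOLOGICAL on the part of `H_{B_N}` over `(l·Δ_Θ)_{B_N}` for every subquotient datum `P` satisfying the two row-2
laws: `hlift` (an element of `H_{B_N}` lying in `P.pre` lifts to `Π^tp_Ÿ̲ ∩ θ⁻¹(l·Δ_Θ)`) and `hP` (`P.proj ∘ ρ = e ∘ thetaMod`
on such lifts).  The mathematics is abc-iut-L2-t2/t8's `RigidData.cocycle_lDeltaTheta` (Prop. 1.3 / 1.5 (iii) via
Rmk. 2.19.2).  [cite: MochizukiEtTh2009, Prop 5.5 proof p.327 (PDF p.101)] -/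
theorem etaTautological_ofBiKummerData
    {η₀ : RD.PiYdd → RD.mu} (hη₀ : η₀ ∈ RD.thetaCocycles)
    (e : RD.mu → (ofBiKummerData h toB Q odd_l R ιX hopen σ K' constEmb constEmb_injective hdivc hdivp).lDeltaModN
      (ofBiKummerData h toB Q odd_l R ιX hopen σ K' constEmb constEmb_injective hdivc hdivp).BN)
    (η : (ofBiKummerData h toB Q odd_l R ιX hopen σ K' constEmb constEmb_injective hdivc hdivp).HB →
      (ofBiKummerData h toB Q odd_l R ιX hopen σ K' constEmb constEmb_injective hdivc hdivp).lDeltaModN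
        (ofBiKummerData h toB Q odd_l R ιX hopen σ K' constEmb constEmb_injective hdivc hdivp).BN)
    (hη : ∀ k : RD.PiYdd, η ⟨rhoOfBiKummerData R ιX k, Subgroup.mem_map_of_mem _ k.2⟩ = e (η₀ k))
    (P : ThetaSubquotientProj (ofBiKummerData h toB Q odd_l R ιX hopen σ K' constEmb constEmb_injective hdivc hdivp))
    (hlift : ∀ a ∈ (ofBiKummerData h toB Q odd_l R ιX hopen σ K' constEmb constEmb_injective hdivc hdivp).HB,
      a ∈ P.pre _ → ∃ k : RD.PiYdd, (k : RD.PiX) ∈ RD.lDeltaTheta ∧ rhoOfBiKummerData R ιX k = a)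
    (hP : ∀ (k : RD.PiYdd) (hk : (k : RD.PiX) ∈ RD.lDeltaTheta) (hm : rhoOfBiKummerData R ιX k ∈ P.pre _),
      (QuotientGroup.mk (P.proj _ ⟨rhoOfBiKummerData R ιX k, hm⟩) :
          (ofBiKummerData h toB Q odd_l R ιX hopen σ K' constEmb constEmb_injective hdivc hdivp).lDeltaModN
            (ofBiKummerData h toB Q odd_l R ιX hopen σ K' constEmb constEmb_injective hdivc hdivp).BN) =
        e (RD.thetaMod ⟨k, hk⟩)) :
    Thm56Sub.EtaTautological (ofBiKummerData h toB Q odd_l R ιX hopen σ K' constEmb constEmb_injective hdivc hdivp)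
      P η := by
  rintro ⟨a, haHB⟩ ha
  obtain ⟨k, hk, rfl⟩ := hlift a haHB ha
  rw [hP k hk ha, ← RD.cocycle_lDeltaTheta η₀ hη₀ k hk]
  exact hη k

/-- **EtTh:Prop5.5/P55-L02, with the descent included**: under the single `η`-side input `hdies` («the mod-`N` étale
theta class dies on `Π_{B_N} ∩ Π^tp_Ÿ̲̲`», i.e. `B_N` is an `l·N`-codomain — Prop. 5.2 (i)/(iii); GAP-LEDGER G-w5d123-1)
and the row-2 laws `hlift`, `hP` of the subquotient datum (GAP-LEDGER G-w5d123-2), there IS an `η` on `H_{B_N}`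
descending the theta cocycle `η₀` through `e`, and it is tautological on the `(l·Δ_Θ)_{B_N}`-part:
`EtaTautological 𝔉 P η`. [cite: MochizukiEtTh2009, Prop 5.5 proof p.327 (PDF p.101)] -/
theorem exists_eta_etaTautological_ofBiKummerData
    {η₀ : RD.PiYdd → RD.mu} (hη₀ : η₀ ∈ RD.thetaCocycles)
    (hdies : ∀ k : RD.PiYdd, rhoOfBiKummerData R ιX k = 1 → η₀ k = 1)
    (e : RD.mu → (ofBiKummerData h toB Q odd_l R ιX hopen σ K' constEmb constEmb_injective hdivc hdivp).lDeltaModN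
      (ofBiKummerData h toB Q odd_l R ιX hopen σ K' constEmb constEmb_injective hdivc hdivp).BN)
    (P : ThetaSubquotientProj (ofBiKummerData h toB Q odd_l R ιX hopen σ K' constEmb constEmb_injective hdivc hdivp))
    (hlift : ∀ a ∈ (ofBiKummerData h toB Q odd_l R ιX hopen σ K' constEmb constEmb_injective hdivc hdivp).HB,
      a ∈ P.pre _ → ∃ k : RD.PiYdd, (k : RD.PiX) ∈ RD.lDeltaTheta ∧ rhoOfBiKummerData R ιX k = a)
    (hP : ∀ (k : RD.PiYdd) (hk : (k : RD.PiX) ∈ RD.lDeltaTheta) (hm : rhoOfBiKummerData R ιX k ∈ P.pre _),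
      (QuotientGroup.mk (P.proj _ ⟨rhoOfBiKummerData R ιX k, hm⟩) :
          (ofBiKummerData h toB Q odd_l R ιX hopen σ K' constEmb constEmb_injective hdivc hdivp).lDeltaModN
            (ofBiKummerData h toB Q odd_l R ιX hopen σ K' constEmb constEmb_injective hdivc hdivp).BN) =
        e (RD.thetaMod ⟨k, hk⟩)) :
    ∃ η : (ofBiKummerData h toB Q odd_l R ιX hopen σ K' constEmb constEmb_injective hdivc hdivp).HB →
        (ofBiKummerData h toB Q odd_l R ιX hopen σ K' constEmb constEmb_injective hdivc hdivp).lDeltaModN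
          (ofBiKummerData h toB Q odd_l R ιX hopen σ K' constEmb constEmb_injective hdivc hdivp).BN,
      (∀ k : RD.PiYdd, η ⟨rhoOfBiKummerData R ιX k, Subgroup.mem_map_of_mem _ k.2⟩ = e (η₀ k)) ∧
      Thm56Sub.EtaTautological (ofBiKummerData h toB Q odd_l R ιX hopen σ K' constEmb constEmb_injective hdivc hdivp)
        P η := by
  obtain ⟨η, hη⟩ := RD.toThetaEnvData.exists_descent_thetaCocycle (rhoOfBiKummerData R ιX) hη₀ hdies e
  exact ⟨η, hη, etaTautological_ofBiKummerData h toB Q odd_l R ιX hopen σ K' constEmb constEmb_injective hdivc hdivp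
    hη₀ e η hη P hlift hP⟩

end ThetaFrobenioid

end Literature.AnabelianGeometry.EtaleTheta

end
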